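import Summits.BirchSwinnertonDyer.BirchSwinnertonDyer.Theorems.KatoDescentPotSupersingularReducibleReflectionCore
import HarnessLib

/-!
# THE REFLECTION CORE of crux M, second orientation: `χ₂` ODD (`ℚ(P′)` imaginary — the K8-t′ rows at `p = 5` with an imaginary cyclic
# quartic `ℚ(P′)`), the layer-zero eigen-test of the EVEN field `ℚ(P)` from an EIGENCLASS test on the ODD field, by LEOPOLDT REFLECTION
# (`Literature/…/LeopoldtReflectionIsotypic*.lean`; companion of `…ReducibleReflectionCore` = the `χ₁`-odd orientation)
# (route-free helper for crux M = stmt-BirchSwinnertonDyer-19196 `ReducibleKatoMember`, K9 / K8-t′; seat `bsd-potss-rkm` g41)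

Same mathematics as `…ReducibleReflectionCore` with the roles of (`P`, `χ₁`, «`τP = aP`») and (`P₂ mod C`, `χ₂`, «`τP₂ − aP₂ ∈ C`»)
exchanged: exponent systems `ψ = χ₁` (even), `a = χ₂` (odd), `ω = χ₂χ₁` (`det ρ̄ = ω` on `ζ = e_p(P,P₂)`); the `χ₁`-eigenfunctional on
`Cl(K₁)` pulls back to the CM field `L = ℚ(χ₁,χ₂)`, reflects into an `ωψ⁻¹ = χ₂`-eigenclass and descends to `Cl(K₂)[p]`, killed by the
eigenclass test on the odd field `K₂`.
* `eigenTest_even₁_of_eigenClass_test_odd₂` — THE CORE in the second orientation.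
HONEST FRAMING.  Theorems only; route-free; closes nothing; crux M stays cite-level over {Fine, H2X⁺, modularity} ⊕ `H_IC`; no class number is
computed in Lean; BSD is proved for no curve.  References: [Washington1997] §10.2 Thm. 10.9/10.11; [Lang1990] Ch. 13 §2 Thm. 2.1;
[CoatesSujatha2005] Thm. 3.4, Cor. 3.6; [DeoRaySujatha2023] §3 Thm. 3.8; [Serre1972] §4.
-/

-- the summit and its single problem are both named `BirchSwinnertonDyer` (registry layout D-0017)
set_option linter.dupNamespace false
set_option autoImplicit false

noncomputable section

open scoped Classical Pointwise NumberField nonZeroDivisors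
open Field NumberField IsDedekindDomain IntermediateField WeierstrassCurve
open Literature.NumberTheory.EllipticCurves Literature.NumberTheory.EllipticCurves.GreenbergSelmer
open Literature.NumberTheory.GaloisRepresentations Literature.NumberTheory.IwasawaTheory Literature.NumberTheory.NumberFields
open Literature.NumberTheory.EllipticCurves.FineSelmerReducibleIsotypic Literature.NumberTheory.EllipticCurves.CoatesSujatha2005
open Literature.NumberTheory.EllipticCurves.ZpExtension
open Summit.BirchSwinnertonDyer.BirchSwinnertonDyer.Theorems
open Summit.BirchSwinnertonDyer.BirchSwinnertonDyer.Theorems.ReducibleFineSelmerCharacterFields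
open Summit.BirchSwinnertonDyer.BirchSwinnertonDyer.Theorems.ReducibleFineSelmerLayerZero

namespace Summit.BirchSwinnertonDyer.BirchSwinnertonDyer.Theorems.ReducibleFineSelmerReflection

section DoorTwo

variable (W : WeierstrassCurve ℚ) [W.IsElliptic] {p : ℕ} [Fact p.Prime]

set_option maxHeartbeats 800000 in -- one long assembly proof (many `choose`s over `Gal(L/ℚ)`); splitting it would duplicate the set-up
/-- **THE REFLECTION CORE, second orientation: the layer-zero eigen-test on the EVEN side (`K₁`, `χ₁`) from an EIGENCLASS TEST on the ODD
side (`K₂`, `χ₂`).**  Data: `C` a stable line of `W[p]` (`p` odd), `P ∈ C ∖ 0`, `P₂ ∉ C`; `τ₀ ∈ Γ_ℚ` inducing a complex conjugation on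
`L = ℚ(χ₁,χ₂)` with `τ₀•P₂ − (p−1)•P₂ ∈ C` (`χ₂` ODD); `χ₁ ≠ 1`; subfields `K₁, K₂ ⊆ L` (number fields) whose fixators fix `P`, resp. `P₂ mod C`;
and the EIGENCLASS TEST on `K₂`: every `x ∈ Cl(K₂)` with `x^p = 1` and `σ • x = x^a` whenever `τ ↦ σ` on `K₂` and `τP₂ − aP₂ ∈ C` is trivial.
THEN g39's layer-zero eigen-test holds on side 1 (`K₁`, «`τP = aP`»).
[cite: Washington1997, §10.2, Thm. 10.9 and Thm. 10.11] [cite: Lang1990, Ch. 13 §2, Thm. 2.1] [cite: Serre1972, §4 (Borel image: χ₁χ₂ = det = χ)]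
[cite: DeoRaySujatha2023, §3 Thm. 3.8 (c2)] -/
theorem eigenTest_even₁_of_eigenClass_test_odd₂ (hp : p ≠ 2)
    (C : AddSubgroup (W.geomTorsion (p : ℤ)))
    (hC : ∀ (σ : absoluteGaloisGroup ℚ) (x : W.geomTorsion (p : ℤ)), x ∈ C → σ • x ∈ C)
    (h1 : C ≠ ⊥) (h2 : C ≠ ⊤)
    (P : W.geomTorsion (p : ℤ)) (hPC : P ∈ C) (hP0 : P ≠ 0)
    (P₂ : W.geomTorsion (p : ℤ)) (hP₂ : P₂ ∉ C)
    (K₁ : haveI : NeZero p := ⟨(Fact.out : p.Prime).ne_zero⟩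
      haveI := isGalois_borelField (W := W) hC
      IntermediateField ℚ (W.borelField C))
    (hK₁ : NumberField K₁)
    (K₂ : haveI : NeZero p := ⟨(Fact.out : p.Prime).ne_zero⟩
      haveI := isGalois_borelField (W := W) hC
      IntermediateField ℚ (W.borelField C))
    (hK₂ : NumberField K₂)
    (hK₂P : haveI : NeZero p := ⟨(Fact.out : p.Prime).ne_zero⟩
      haveI := isGalois_borelField (W := W) hC
      ∀ τ : absoluteGaloisGroup ℚ,
        (∀ x : K₂, absRestrictNormalHom (W.borelField C) τ (x : W.borelField C) = x) → τ • P₂ - P₂ ∈ C)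
    (τ₀ : absoluteGaloisGroup ℚ)
    (hτ₀ : haveI : NeZero p := ⟨(Fact.out : p.Prime).ne_zero⟩
      haveI := isGalois_borelField (W := W) hC
      ∃ φ : ↥(W.borelField C) →+* ℂ, ∀ x : ↥(W.borelField C),
        φ (absRestrictNormalHom (W.borelField C) τ₀ x) = starRingEnd ℂ (φ x))
    (hτP₂ : τ₀ • P₂ - (p - 1) • P₂ ∈ C)
    (hne₁ : ∃ τ : absoluteGaloisGroup ℚ, τ • P ≠ P)
    (hkill₂ : haveI : NeZero p := ⟨(Fact.out : p.Prime).ne_zero⟩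
      haveI := isGalois_borelField (W := W) hC
      haveI := hK₂
      ∀ x : ClassGroup (𝓞 K₂), x ^ p = 1 →
        (∀ (τ : absoluteGaloisGroup ℚ) (σ : K₂ ≃ₐ[ℚ] K₂) (a : ℕ),
          (∀ y : K₂, absRestrictNormalHom (W.borelField C) τ (y : W.borelField C) = ((σ y : K₂) : W.borelField C)) →
          τ • P₂ - a • P₂ ∈ C → ClassGroup.mulEquiv (AmbiguousClass.intAut σ) x = x ^ a) → x = 1) :
    haveI : NeZero p := ⟨(Fact.out : p.Prime).ne_zero⟩
    haveI := isGalois_borelField (W := W) hC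
    haveI := hK₁
    ∀ μ : Additive (ClassGroup (𝓞 K₁)) →+ ZMod p,
      (∀ (τ : absoluteGaloisGroup ℚ) (σ : K₁ ≃ₐ[ℚ] K₁) (a : ℕ),
        (∀ x : K₁, absRestrictNormalHom (W.borelField C) τ (x : W.borelField C) = ((σ x : K₁) : W.borelField C)) →
        τ • P = a • P →
        ∀ (I J : (Ideal (𝓞 K₁))⁰),
          (J : Ideal (𝓞 K₁)) = (I : Ideal (𝓞 K₁)).map (AmbiguousClass.intAut σ : 𝓞 K₁ →+* 𝓞 K₁) →
          μ (Additive.ofMul (ClassGroup.mk0 J)) = a • μ (Additive.ofMul (ClassGroup.mk0 I))) →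
      μ = 0 := by
  have hpr : p.Prime := Fact.out
  haveI : NeZero p := ⟨hpr.ne_zero⟩
  haveI := isGalois_borelField (W := W) hC
  haveI := hK₁
  haveI := hK₂
  have hp2' : 2 < p := lt_of_le_of_ne hpr.two_le (Ne.symm hp)
  intro μ hμtest
  haveI : FiniteDimensional ℚ (W.borelField C) := finiteDimensional_borelField C
  haveI : NumberField (W.borelField C) := NumberField.mk
  have hV : Nat.card (W.geomTorsion (p : ℤ)) = p ^ 2 := W.natCard_geomTorsion_eq_sq_of_charZero hpr
  have hcard : Nat.card C = p := W.card_eq_of_ne_bot_of_ne_top hV h1 h2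
  have hab : IsAbelianGalois ℚ ↥(W.borelField C) := isAbelianGalois_borelField (W := W) hC hcard hV
  haveI := hab
  have hcommL := fun g σ => hab.toIsMulCommutative.is_comm.comm g σ
  haveI : IsAbelianGalois ℚ ↥K₂ := @IsAbelianGalois.tower_bot ℚ ↥K₂ ↥(W.borelField C) _ _ _ _ _ _ _ hab
  obtain ⟨ζ, hζ, hζact⟩ := W.exists_isPrimitiveRoot_borelField_smul_eq_pow C hC h1 h2 P hPC hP0 P₂ hP₂
  haveI : IsTotallyComplex ↥(W.borelField C) :=
    ReducibleFineSelmerImaginaryQuadraticThree.isTotallyComplex_of_isPrimitiveRoot hζ hp2'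
  have hdeg : Module.finrank ℚ ↥(W.borelField C) ∣ (p - 1) ^ 2 := W.finrank_borelField_dvd hC h1 h2
  have hpdeg : ¬ p ∣ (p - 1) ^ 2 := fun h => by
    have h1' := Nat.le_of_dvd (Nat.sub_pos_of_lt hpr.one_lt) (hpr.dvd_of_dvd_pow h)
    omega
  have hdvd_of : ∀ E : IntermediateField ℚ ↥(W.borelField C), ¬ p ∣ Module.finrank ↥E ↥(W.borelField C) := by
    intro E h
    exact hpdeg ((h.trans (Dvd.intro_left _ (Module.finrank_mul_finrank ℚ ↥E ↥(W.borelField C)))).trans hdeg)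
  have hsurj := absRestrictNormalHom_surjective₅ (W.borelField C)
  choose lift hlift using hsurj
  have hsc₁ : ∀ τ : absoluteGaloisGroup ℚ, ∃ a : ℕ, τ • P = a • P := by
    intro τ
    obtain ⟨a, ha'⟩ := exists_forall_smul_eq_zsmul_of_card_eq hC hcard τ
    obtain ⟨n, hn⟩ := exists_nsmul_eq_zsmul W P a
    exact ⟨n, by rw [ha' P hPC, ← hn, natCast_zsmul]⟩
  choose a₁ ha₁ using hsc₁
  have hsc₂ : ∀ τ : absoluteGaloisGroup ℚ, ∃ a : ℕ, τ • P₂ - a • P₂ ∈ C := by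
    intro τ
    obtain ⟨a, ha'⟩ := exists_forall_smul_sub_zsmul_mem hC hcard hV τ
    obtain ⟨n, hn⟩ := exists_nsmul_eq_zsmul W P₂ a
    exact ⟨n, by rw [← natCast_zsmul, hn]; exact ha' P₂⟩
  choose a₂ ha₂ using hsc₂
  have hA : ∀ σ (τ : absoluteGaloisGroup ℚ),
      absRestrictNormalHom (W.borelField C) τ = σ → a₁ (lift σ) ≡ a₁ τ [MOD p] ∧ a₂ (lift σ) ≡ a₂ τ [MOD p] := by
    intro σ τ hτ
    obtain ⟨hCeq, hVeq⟩ := smul_eq_smul_of_absRestrictNormalHom_eq W C hC (lift σ) τ (by rw [hlift, hτ])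
    refine ⟨modEq_of_nsmul_eq_nsmul W hP0 (by rw [← ha₁, ← ha₁, hCeq P hPC]), modEq_of_nsmul_sub_nsmul_mem W C hP₂ ?_⟩
    have e : a₂ (lift σ) • P₂ - a₂ τ • P₂ =
        -((lift σ) • P₂ - a₂ (lift σ) • P₂) + ((lift σ) • P₂ - τ • P₂) + (τ • P₂ - a₂ τ • P₂) := by abel
    rw [e]
    exact C.add_mem (C.add_mem (C.neg_mem (ha₂ _)) (hVeq P₂)) (ha₂ τ)
  /- exponent systems: `ψ = χ₁` (even), `a = χ₂` (odd), `ω = χ₂χ₁` -/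
  let a := fun σ => a₂ (lift σ)
  let ψ := fun σ => a₁ (lift σ)
  let ω := fun σ => a₂ (lift σ) * a₁ (lift σ)
  have haψ : ∀ σ, ω σ = a σ * ψ σ := fun σ => rfl
  have hω : ∀ σ, σ ζ = ζ ^ ω σ := by
    intro σ
    have h := hζact (lift σ) (a₁ (lift σ)) (a₂ (lift σ)) (ha₁ _) (ha₂ _)
    rw [hlift, mul_comm] at h
    exact h
  let c₀ := absRestrictNormalHom (W.borelField C) τ₀
  have hc₀ : ∀ x, c₀ x = IsCMField.complexConj ↥(W.borelField C) x := by
    obtain ⟨φ, hφ⟩ := hτ₀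
    intro x
    apply φ.injective
    rw [IsCMField.complexEmbedding_complexConj]
    exact hφ x
  have hac₀ : a c₀ ≡ p - 1 [MOD p] := by
    refine ((hA c₀ τ₀ rfl).2).trans (modEq_of_nsmul_sub_nsmul_mem W C hP₂ ?_)
    have e : a₂ τ₀ • P₂ - (p - 1) • P₂ = -(τ₀ • P₂ - a₂ τ₀ • P₂) + (τ₀ • P₂ - (p - 1) • P₂) := by abel
    rw [e]
    exact C.add_mem (C.neg_mem (ha₂ τ₀)) hτP₂
  have hψc₀ : ψ c₀ ≡ 1 [MOD p] :=
    IsCMField.modEq_one_of_mul_of_complexConj ℚ ↥(W.borelField C) hpr hζ a ψ ω hω haψ c₀ hc₀ hac₀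
  have hψ : ∃ σ, ¬ ψ σ ≡ 1 [MOD p] := by
    obtain ⟨τ, hτ⟩ := hne₁
    refine ⟨absRestrictNormalHom (W.borelField C) τ, fun h => hτ ?_⟩
    have h3 : a₁ τ ≡ 1 [MOD p] := ((hA _ τ rfl).1).symm.trans h
    have h4 : a₁ τ • P = (1 : ℕ) • P := by
      have hpP : p • P = 0 := Subtype.ext (by
        rw [AddSubmonoidClass.coe_nsmul, ZeroMemClass.coe_zero]; exact AddSubgroup.torsionBy.nsmul_iff.mp P.2)
      rw [nsmul_eq_nsmul_iff_modEq, addOrderOf_eq_prime hpP hP0]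
      exact h3
    rw [ha₁, h4, one_smul]
  -- `a₁(lift σ) · a₁(lift σ⁻¹) ≡ 1`
  have ha₁inv : ∀ σ, a₁ (lift σ) * a₁ (lift σ⁻¹) ≡ 1 [MOD p] := by
    intro σ
    apply modEq_of_nsmul_eq_nsmul W hP0
    have e3 := (smul_eq_smul_of_absRestrictNormalHom_eq W C hC (lift σ * lift σ⁻¹) 1
      (by rw [map_mul, hlift, hlift, map_one, mul_inv_cancel])).1 P hPC
    rw [one_smul, mul_smul, ha₁ (lift σ⁻¹), smul_nsmul_geomTorsion, ha₁ (lift σ), smul_smul,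
      mul_comm (a₁ (lift σ⁻¹)) (a₁ (lift σ))] at e3
    rw [e3, one_smul]
  -- on `Gal(L/K₂)` the exponent `ω ψ⁻¹ = χ₂` is trivial
  have hfix : ∀ h : ↥(W.borelField C) ≃ₐ[↥K₂] ↥(W.borelField C),
      ω (h.restrictScalars ℚ) * ψ (h.restrictScalars ℚ)⁻¹ ≡ 1 [MOD p] := by
    intro h
    have e1 : a₂ (lift (h.restrictScalars ℚ)) ≡ 1 [MOD p] := by
      refine modEq_of_nsmul_sub_nsmul_mem W C hP₂ ?_
      have hfx : lift (h.restrictScalars ℚ) • P₂ - P₂ ∈ C := by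
        refine hK₂P _ fun x => ?_
        rw [hlift]
        exact h.commutes x
      have e : a₂ (lift (h.restrictScalars ℚ)) • P₂ - (1 : ℕ) • P₂ =
          -(lift (h.restrictScalars ℚ) • P₂ - a₂ (lift (h.restrictScalars ℚ)) • P₂) + (lift (h.restrictScalars ℚ) • P₂ - P₂) := by
        rw [one_smul]; abel
      rw [e]
      exact C.add_mem (C.neg_mem (ha₂ _)) hfx
    have e7 := e1.mul (ha₁inv (h.restrictScalars ℚ))
    rw [one_mul] at e7
    calc ω (h.restrictScalars ℚ) * ψ (h.restrictScalars ℚ)⁻¹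
        = a₂ (lift (h.restrictScalars ℚ)) * (a₁ (lift (h.restrictScalars ℚ)) * a₁ (lift (h.restrictScalars ℚ)⁻¹)) :=
          mul_assoc _ _ _
      _ ≡ 1 [MOD p] := e7
  /- the odd side: the eigenclass test on `K₂` in the reflection theorem's currency -/
  have hkill : ∀ x : ClassGroup (𝓞 ↥K₂), x ^ p = 1 →
      (∀ σ (σK : ↥K₂ ≃ₐ[ℚ] ↥K₂), (∀ y : ↥K₂, σ (algebraMap ↥K₂ ↥(W.borelField C) y) = algebraMap ↥K₂ ↥(W.borelField C) (σK y)) →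
        ClassGroup.mulEquiv (AmbiguousClass.intAut σK) x = x ^ (ω σ * ψ σ⁻¹)) → x = 1 := by
    intro x hxp H
    refine hkill₂ x hxp fun τ σK b hcompat hτb => ?_
    have hm := H (absRestrictNormalHom (W.borelField C) τ) σK fun y => hcompat y
    have e1 : a₂ (lift (absRestrictNormalHom (W.borelField C) τ)) ≡ b [MOD p] := by
      refine (hA _ τ rfl).2.trans (modEq_of_nsmul_sub_nsmul_mem W C hP₂ ?_)
      have e : a₂ τ • P₂ - b • P₂ = -(τ • P₂ - a₂ τ • P₂) + (τ • P₂ - b • P₂) := by abel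
      rw [e]
      exact C.add_mem (C.neg_mem (ha₂ τ)) hτb
    have e2 := ha₁inv (absRestrictNormalHom (W.borelField C) τ)
    have e3 : ω (absRestrictNormalHom (W.borelField C) τ) * ψ (absRestrictNormalHom (W.borelField C) τ)⁻¹ ≡ b * 1 [MOD p] := by
      calc ω (absRestrictNormalHom (W.borelField C) τ) * ψ (absRestrictNormalHom (W.borelField C) τ)⁻¹
          = a₂ (lift (absRestrictNormalHom (W.borelField C) τ)) *
              (a₁ (lift (absRestrictNormalHom (W.borelField C) τ)) * a₁ (lift (absRestrictNormalHom (W.borelField C) τ)⁻¹)) :=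
            mul_assoc _ _ _
        _ ≡ b * 1 [MOD p] := e1.mul e2
    rw [mul_one] at e3
    rw [hm]
    obtain hx1 | hx1 := eq_or_ne x 1
    · rw [hx1, one_pow, one_pow]
    · rw [pow_eq_pow_iff_modEq, orderOf_eq_prime hxp hx1]
      exact e3
  /- the even side: `Gal(L/ℚ)` restricts to `K₁` and `μ` is a `ψ`-eigenfunctional -/
  have hμ : ∀ σ, ∃ σK : ↥K₁ ≃ₐ[ℚ] ↥K₁,
      (∀ y : ↥K₁, σ (algebraMap ↥K₁ ↥(W.borelField C) y) = algebraMap ↥K₁ ↥(W.borelField C) (σK y)) ∧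
      ∀ d : ClassGroup (𝓞 ↥K₁),
        μ (Additive.ofMul (ClassGroup.mulEquiv (AmbiguousClass.intAut σK) d)) = (ψ σ : ZMod p) * μ (Additive.ofMul d) := by
    intro σ
    obtain ⟨σK, hσK⟩ := exists_algEquiv_restrict_of_forall_mem (K := ℚ) K₁ σ
      (fun y hy => algEquiv_mem_of_isMulCommutative (K := ℚ) hcommL K₁ σ y hy)
      (fun y hy => algEquiv_mem_of_isMulCommutative (K := ℚ) hcommL K₁ σ.symm y hy)
    refine ⟨σK, fun y => (hσK y).symm, fun d => ?_⟩
    obtain ⟨I, rfl⟩ := ClassGroup.mk0_surjective d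
    have key := hμtest (lift σ) σK (a₁ (lift σ)) (fun x => by rw [hlift]; exact (hσK x).symm) (ha₁ _) I
      ⟨_, AmbiguousClass.map_mem_nonZeroDivisors σK I⟩ rfl
    exact (congrArg (fun c => μ (Additive.ofMul c)) (AmbiguousClass.mulEquiv_mk0 σK I)).trans
      (key.trans (nsmul_eq_mul _ _))
  exact IsCMField.eigenHom_eq_zero_of_reflection_of_eigenClass_test ℚ ↥(W.borelField C) hpr hp hζ ψ ω hω c₀ hc₀ hψc₀ hψ
    ↥K₁ (hdvd_of K₁) ↥K₂ (hdvd_of K₂) hfix hkill μ hμ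

end DoorTwo

end Summit.BirchSwinnertonDyer.BirchSwinnertonDyer.Theorems.ReducibleFineSelmerReflection

end
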